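import Mathlib
import HarnessLib
import HarnessLib.Audit
import Summits.CriticalPhenomena.Statement
import Literature.Probability.RandomPlanarGeometry.SLEConvergenceCriterion
import Literature.Probability.RandomPlanarGeometry.SLELawOfDrivingProcessLocal
import Literature.Probability.RandomPlanarGeometry.DrivingFunctionMeasurable
import HarnessLib.Audit.Status.Attr

/-!
Route: SAWImaginaryGeometry

DORMANT since 2026-08-25T12:40:23Z (reconciler: no traction for 7.7 d (last activity item-evidence-added at 2026-08-17T19:14:43Z); parked, not closed — `ledger route dormant route-CriticalPhenomena-SAWImaginaryGeometry --off` to reactiv) — unstaffed, not closed; items shared with open routes are served there. `ledger route dormant <id> --off` reactivates.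

# Route SAWImaginaryGeometry — SAW = κ=8/3 imaginary-geometry flow line — identify the limit by the
martingale arg(g_t−W_t) + ⅓·arg g_t′ (winding in Dirichlet data, not in a phase)

It suffices to show X_IG = (IG) ∧ (KS) ∧ (T) [route realising idea card
imaginary-geometry-winding-dirichlet and absorbing its retired companion ig-seamless-companion
(grafts C1, C2, C4)]:
 (IG) IGMartingaleLimit: for every Dobrushin domain (Ω; a, b), every endpoint approximation
(Literature.Probability.RandomPlanarGeometry.SAW.IsEndpointApprox), every subsequential weak limit μ
(probability measure on CurveClass ℂ) of the critical δℤ² SAW laws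
Literature.Probability.RandomPlanarGeometry.SAW.law and every chordal uniformizer φ : ℍ → Ω (0 ↦ a,
∞ ↦ b): if μ-a.e. curve class is Loewner-describable through φ then, with W = drivingFunction φ (the
Loewner transform of the curve) and g_t = Loewner.map W t, the time-limited κ = 8/3
IMAGINARY-GEOMETRY OBSERVABLE H_t(z) = arg(g_t(z) − W_t) + (1/3)·arg g_t′(z) (t frozen at (Im z)²/9)
satisfies the cylinder (martingale) identity ∫ (H_t(z) − H_s(z))·ψ(W_(S_1), …, W_(S_n)) dμ = 0 for
all z ∈ ℍ, s ≤ t, S_k ≤ s and continuous |ψ| ≤ 1. Up to the affine normalisation 𝔥 = λ − (2λ/π)·H (λ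
= π/√κ) this H is the Miller–Sheffield flow-line harmonic function 𝔥_t = E[h | η[0,t]] (GFF data ∓λ
on ∂Ω, ∓λ′ + χ·winding on the curve, χ = 2/√κ − √κ/2); the coefficient of arg g_t′ is (4−κ)/4 =
πχ/(2λ), equal to 1/3 exactly at κ = 8/3 (χ² = 1/6, central charge 0): the SAW observable is "the
harmonic explorer plus one third of the winding".
 (KS) SubseqDescribable: every such μ is carried by curves Loewner-describable through every chordal
uniformizer (the Kemppainen–Smirnov regularity output).
 (T) EventualTight: eventual tightness of the SAW laws along δ → 0⁺ (shared item
stmt-CriticalPhenomena-1881; never the refuted all-δ form stmt-CriticalPhenomena-0772).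
Given X_IG, the support IGDrivingMartingales (far-field coefficients of H are W_t and W_t² − (8/3)t)
and the PROVED tree theorems
Literature.Probability.RandomPlanarGeometry.isSLELaw_of_isLocalMartingale_driving_of_lt_four (κ =
8/3 < 4: Lévy + trace + transience, no named fact) and
Literature.Probability.RandomPlanarGeometry.convergesInLawToSLE_of_isTightAlongMesh (Prokhorov;
uniqueness Literature.Probability.RandomPlanarGeometry.IsSLECurve.map_eq_holds) give
SAWScalingLimit. The lattice ENGINE behind (IG) is crux 3 FlowLineMeanValue — the lattice-averaged
flow-line mean-value identity E^SAW[X_γ(z)] − X_∅(z) → 0 for the two-sided discrete harmonic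
extension of the winding data, slit-uniformly — filed informally after open (its two definitions are
requested), see Definition requests.
Lean: `(∀ (D : Literature.Probability.RandomPlanarGeometry.DobrushinDomain) (a b : ℝ →
Literature.Probability.LatticeModels.Site 2),
Literature.Probability.RandomPlanarGeometry.SAW.IsEndpointApprox D a b → ∀ (s : ℕ → ℝ) (μ :
MeasureTheory.Measure (Literature.Probability.RandomPlanarGeometry.CurveClass ℂ)), Filter.Tendsto s
Filter.atTop (nhdsWithin 0 (Set.Ioi 0)) → MeasureTheory.IsProbabilityMeasure μ → (∀ f :
BoundedContinuousFunction (Literature.Probability.RandomPlanarGeometry.CurveClass ℂ) ℝ,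
Filter.Tendsto (fun n => ∫ γ, f γ.curve ∂(Literature.Probability.RandomPlanarGeometry.SAW.law
D.carrier (s n) (a (s n)) (b (s n)))) Filter.atTop (nhds (∫ x, f x ∂μ))) → ∀ φ :
Literature.Probability.RandomPlanarGeometry.ConformalEquiv UpperHalfPlane.upperHalfPlaneSet
D.carrier, D.IsChordalUniformizing φ → (∀ᵐ c ∂μ,
Literature.Probability.RandomPlanarGeometry.IsLoewnerDescribable φ c) → (let H :
Literature.Probability.RandomPlanarGeometry.CurveClass ℂ → NNReal → ℂ → ℝ := fun c t z =>
Complex.arg (Literature.Probability.RandomPlanarGeometry.Loewner.map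
(Literature.Probability.RandomPlanarGeometry.drivingFunction φ c) (min t (z.im ^ 2 / 9).toNNReal) z
- (Literature.Probability.RandomPlanarGeometry.drivingFunction φ c (min t (z.im ^ 2 / 9).toNNReal) :
ℂ)) + (1 / 3 : ℝ) * Complex.arg (deriv (Literature.Probability.RandomPlanarGeometry.Loewner.map
(Literature.Probability.RandomPlanarGeometry.drivingFunction φ c) (min t (z.im ^ 2 / 9).toNNReal))
z); ∀ z : ℂ, 0 < z.im → ∀ s' t' : NNReal, s' ≤ t' → ∀ (n : ℕ) (S : Fin n → NNReal), (∀ k, S k ≤ s')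
→ ∀ ψ : (Fin n → ℝ) → ℝ, Continuous ψ → (∀ v, |ψ v| ≤ 1) → ∫ c, (H c t' z - H c s' z) * ψ (fun k =>
Literature.Probability.RandomPlanarGeometry.drivingFunction φ c (S k)) ∂μ = 0)) ∧ (∀ (D :
Literature.Probability.RandomPlanarGeometry.DobrushinDomain) (a b : ℝ →
Literature.Probability.LatticeModels.Site 2),
Literature.Probability.RandomPlanarGeometry.SAW.IsEndpointApprox D a b → ∀ (s : ℕ → ℝ) (μ :
MeasureTheory.Measure (Literature.Probability.RandomPlanarGeometry.CurveClass ℂ)), Filter.Tendsto s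
Filter.atTop (nhdsWithin 0 (Set.Ioi 0)) → MeasureTheory.IsProbabilityMeasure μ → (∀ f :
BoundedContinuousFunction (Literature.Probability.RandomPlanarGeometry.CurveClass ℂ) ℝ,
Filter.Tendsto (fun n => ∫ γ, f γ.curve ∂(Literature.Probability.RandomPlanarGeometry.SAW.law
D.carrier (s n) (a (s n)) (b (s n)))) Filter.atTop (nhds (∫ x, f x ∂μ))) → ∀ φ :
Literature.Probability.RandomPlanarGeometry.ConformalEquiv UpperHalfPlane.upperHalfPlaneSet
D.carrier, D.IsChordalUniformizing φ → ∀ᵐ c ∂μ,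
Literature.Probability.RandomPlanarGeometry.IsLoewnerDescribable φ c) ∧ (∀ (D :
Literature.Probability.RandomPlanarGeometry.DobrushinDomain) (a b : ℝ →
Literature.Probability.LatticeModels.Site 2),
Literature.Probability.RandomPlanarGeometry.SAW.IsEndpointApprox D a b →
Literature.Probability.RandomPlanarGeometry.IsTightAlongMesh (fun δ (γ :
Literature.Probability.RandomPlanarGeometry.SAW.DomainSAW D.carrier δ (a δ) (b δ)) => γ.curve) (fun
δ => Literature.Probability.RandomPlanarGeometry.SAW.law D.carrier δ (a δ) (b δ)))`

## Assembly
Fix (D, a, b) with IsEndpointApprox. The SAW laws are probability measures for all small δ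
(IsEndpointApprox.reachable; finitely many SAWs in bounded Ω_δ), so replace SAW.law by a
probability-valued family agreeing near 0⁺ (ConvergesInLawToSLE, IsTightAlongMesh and the
subsequential-limit hypotheses only see the germ at 0⁺) and apply
convergesInLawToSLE_of_isTightAlongMesh with huniq := IsSLECurve.map_eq_holds (PROVED), hY :=
SAW.aemeasurable_curve, hT := EventualTight. For hL take a probability μ and a mesh sequence s_n →
0⁺ with ∫ f∘curve d law(s_n) → ∫ f dμ; pick φ by MarkedDomain.exists_isChordalUniformizing_holds
(PROVED); SubseqDescribable gives μ-a.e. describability; IGMartingaleLimit gives the cylinder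
identity for W = drivingFunction φ; set W′ c := drivingFunction φ c on the full-measure set of
describable curves starting at a (a.e. c.source = a by IsEndpointApprox.tendsto_fst and portmanteau)
and 0 elsewhere, so that W′ has strongly measurable marginals (measurable_drivingFunction),
continuous paths and W′_0 = 0 everywhere (drivingFunction_apply_zero), and the cylinder identity
transfers (null modification). IGDrivingMartingales (Ω := CurveClass ℂ, P := μ) yields
IsLocalMartingale (W′/√(8/3)) and quadratic variation t in the natural filtration;
isLoewnerDescribed_iff_isDrivenBy gives μ-a.e. Loewner.IsDrivenBy φ.boundaryExtension (D.pt 1) (W′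
c) c; isSLELaw_of_isLocalMartingale_driving_of_lt_four (0 < 8/3 < 4, Real.sqrt ↑(8/3) = √(8/3) by
norm_num) gives IsSLELaw (8/3) D μ. Unfold SAWScalingLimit =
Literature.Probability.RandomPlanarGeometry.SAW.SAWScalingLimit.

Rationale: WHY THIS LINE. Mechanism: imaginary geometry (MillerSheffield2016 Thms 1.1–1.2; Dubedat2009): SLE_κ
is the flow line of e^(ih/χ) for a GFF h, and 𝔥_t(z) = E[h(z) | η[0,t]] — the harmonic function of
the slit domain carrying the curve's WINDING IN ITS DIRICHLET DATA — is a martingale iff the driver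
is √κ·B with κ = 4 − 2πχ/λ; the SAW is the c = 0 member of Nienhuis' Coulomb gas (Nienhuis1982), c =
1 − 6χ² ⇒ χ² = 1/6 ⇒ κ = 8/3, so instead of the parafermionic phase e^(−i(5/8)W) of
DuminilCopinSmirnov2012 (Conjecture 2, open even on the hexagonal lattice: half of Cauchy–Riemann is
missing) we take its LOGARITHM and let the winding enter linearly as boundary data of a plain,
well-posed Dirichlet problem — the observable type of the two identification theorems that succeeded
on ℤ² without integrability (SchrammSheffield2005 harmonic explorer, SchrammSheffield2009 DGFF
contour lines; also LSW's loop-erased walk). Imported from another area: the GFF/SLE coupling theory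
of random planar geometry and the Coulomb-gas dictionary of CFT, made explicit (χ = 1/√6, λ =
π√(3/8), λ′ = π/√6, coefficient (4−κ)/4 = 1/3, angle gap 2λ′/χ = 2π: the κ = 8/3 flow line "leaves
no seam"), consumed through the tree's proved martingale-identification machinery built for
crit-ising (CDHKSCRAS2014 §3 pattern: cylinder identity → driving local martingales → Lévy → SLE
law). What prior routes do not do: SAWParafermion needs DCS Conjecture 2 (a Riemann–Hilbert problem
with lattice-dependent modulus, KennedyLawler2013), SAWConfRestriction/SAWRestrictionRigidity
identify through restriction, SAWLeftRightFKG/SAWHexUniversality/SAWQuantumGravity through tightness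
or universality transfers; none has a GFF/Dirichlet observable, and the only negative
(stmt-CriticalPhenomena-0772) is steered around by eventual tightness.

RANKED CRUXES. #2 IGMartingaleLimit (crux) — (IG) of the thesis — the κ = 8/3 imaginary-geometry
cylinder identity for every subsequential weak limit of the critical square-lattice SAW laws,
through every chordal uniformizer, given a.e. Loewner describability; this is the card's r2 + r3 in
their continuum, assembly-consumable form (the lattice engine is crux 3 FlowLineMeanValue, informal
until its definitions land). H_t(z) = arg(Loewner.map W T z − W T) + (1/3)·arg(deriv (Loewner.map W
T) z), T = t ∧ (Im z)²/9, W = drivingFunction φ c; in the short-time regime both args are the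
continuous branches (Im(g − W) > 0; |arg g′| ≤ 1/2), so H is bounded. [difficulty: open-problem]
(why it might fail: As strong as SAW→SLE(8/3) given (KS): no lattice engine yet (FlowLineMeanValue
conjectural; no exact Z² identity, NienhuisWeightsExcludeVertexSAW), and IsEndpointApprox admits
interior endpoints a_δ at depth ≫ δ (EndpointRobust stmt-0776 untested).) [MillerSheffield2016,
Dubedat2009, SchrammSheffield2005, SchrammSheffield2009, LawlerSchrammWerner2004SAW,
DuminilCopinSmirnov2012, KennedyLawler2013, CDHKSCRAS2014,
Literature.Probability.RandomPlanarGeometry.drivingFunction,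
Literature.Probability.RandomPlanarGeometry.Loewner.map]
#4 SubseqDescribable (crux) — (KS) of the thesis — for every Dobrushin domain, endpoint
approximation, subsequential weak limit μ (probability) of the SAW laws and chordal uniformizer φ,
μ-a.e. curve class is Loewner-describable through φ
(Literature.Probability.RandomPlanarGeometry.IsLoewnerDescribable: some continuous driving function
generates the curve through φ). Intended engine: Kemppainen–Smirnov Thm 1.5 / Cor 1.7 from an
annulus-crossing bound (Condition G2/C2) for the x_c-SAW in slit domains (the domain Markov property
of the two-point x_c measure is exact); describability through one uniformizer gives it through all
(dilations, Loewner scaling). [difficulty: XL] (why it might fail: No crossing/RSW technology for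
the critical SAW (no FKG at n = 0; KS17 §4 verifies G2 for FK, percolation, HE, LERW only);
sub-ballisticity (DCH13; arXiv:2310.17299 on Hex) is the strongest input; interior-endpoint
approximations are included as typed.) [KemppainenSmirnov2017, AizenmanBurchardDuke1999,
DuminilCopinHammond2013, arXiv:2310.17299, Literature.Probability.RandomPlanarGeometry.ConditionG2,
Literature.Probability.RandomPlanarGeometry.IsLoewnerDescribable,
route-CriticalPhenomena-SAWParafermion item stmt-CriticalPhenomena-0791]
#9 IGDrivingMartingales (support) — continuum extraction, provable now on the pattern of
Loewner.isLocalMartingale_hasQuadraticVariation_of_spinCylinderIdentity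
(SpinObservableLocalMartingale.lean): on any probability space, a real process W with strongly
measurable marginals, continuous paths and W_0 = 0 whose time-limited κ = 8/3 observables H_t(z) =
arg(g_t(z) − W_t) + (1/3)·arg g_t′(z) satisfy the cylinder identity at every z ∈ ℍ has W/√(8/3) a
continuous local martingale with ⟨W/√(8/3)⟩_t = t in its natural filtration. Proof sketch: monotone
class ⇒ H_(·∧T_z)(z) are bounded martingales; far field (FarRegime, g_t = z + 2t/z + 2∫W/z² + …):
H_t(z) − arg z = −W_t·Im(1/z) − ½(W_t² − (8/3)t)·Im(1/z²) + O(((M+√t)/|z|)³); z = iy isolates W_t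
(the 1/y² term vanishes on the axis), z = y·e^(iπ/4) then isolates W_t² − (8/3)t; localise at
far-field stopping times of fixed levels (moment-free), let y → ∞. [difficulty: L] [CDHKSCRAS2014,
MillerSheffield2016,
Literature.Probability.RandomPlanarGeometry.Loewner.isLocalMartingale_hasQuadraticVariation_of_spinCylinderIdentity,
Literature.Probability.RandomPlanarGeometry.Loewner.FarRegime,
Literature.Probability.RandomPlanarGeometry.Loewner.ShortTime]
#9 EventualTight (support) — eventual tightness of the critical SAW laws along δ → 0⁺
(Literature.Probability.RandomPlanarGeometry.IsTightAlongMesh of γ ↦ γ.curve under SAW.law), shared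
verbatim with SAWLeftRightFKG.EventualTight (stmt-CriticalPhenomena-1881): the repaired, eventual
form of the refuted all-δ Tight (stmt-CriticalPhenomena-0772); expected from the same
KS/Aizenman–Burchard input as crux 4. [difficulty: open-problem] [KemppainenSmirnov2017,
AizenmanBurchardDuke1999, Literature.Probability.RandomPlanarGeometry.IsTightAlongMesh,
Summit.CriticalPhenomena.SAWScalingLimit.Theorems.SAWParafermionTight_refuted]

TWO-LAYER PLAN. IGMartingaleLimit ⇐ FlowLineMeanValue → WindingStatistic → DriverConvergence →
IGMartingaleLimit, glue = the tree's proved passage pattern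
Loewner.integral_cylinder_eq_zero_of_tendstoInDistribution (discrete exploration martingales
E[X_γ(z) | γ[0,k]] — martingales by the exact domain Markov property of the x_c-measure, equal to
X_(γ[0,k])(z) + o(1) by FlowLineMeanValue — approximating the continuum functional H along driving
processes converging in law, KS Cor 1.7); filed once FlowLineMeanValue's definitions land and its
signature is set. SubseqDescribable ⇐ SAWConditionG2 (slit-domain annulus-crossing bound for the
x_c-SAW) → KSRegularityFact (Kemppainen–Smirnov Thm 1.5 + Cor 1.7 as a Literature cite fact) →
SubseqDescribable, the same children also giving EventualTight.

KILL CRITERIA. A numerical refutation of FlowLineMeanValue AT SCALE (the κ-dressing test below: the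
coefficient 1/3 is not the unique dressing whose martingale-increment residual decays as the box
doubles, at Kennedy-scale pivot sampling) closes the route (close --reason
refuted:FlowLineMeanValue) — unless the loop-erased-walk control (coefficient (4−2)/4 = 1/2, κ = 2,
where the identity is a theorem-level expectation) also fails, which convicts the lattice winding
convention instead and forces a pivot to the conformally transported data (companion graft C2/C3:
arcs ∓λ exactly, ψ′ along the walk). A refutation of IGMartingaleLimit or SubseqDescribable through
interior-endpoint approximations (EndpointRobust stmt-CriticalPhenomena-0776 false) refutes the
conjunct SAWScalingLimit as typed, not the mechanism: pivot = restate both for boundary-attached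
endpoints and report upstream. A proof elsewhere of SubseqIdentification
(stmt-CriticalPhenomena-0783) moots crux 2; a proof of KS Condition G2 for the SAW
(stmt-CriticalPhenomena-0791) closes crux 4 and EventualTight by citation; a refutation of
IGDrivingMartingales as typed (hypothesis format) is repaired by restating it in the exact format of
the spin theorem, not by closing.

NOT DECOMPOSED YET. FlowLineMeanValue (crux 3, informal at open) waits for two definitions
(edge-data slit Dirichlet extension; the κ = 8/3 flow-line data rule), then gets its signature;
WindingStatistic (convergence of the lattice extension X_(γ_δ)(z) to H for lattice curves converging
in the sup norm — harmonic measure × winding integrability on the two banks, DuplantierBinder2002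
mixed spectrum, Beurling-type estimates so that deep spirals are not charged) and DriverConvergence
are deliberately NOT filed: they are the layer-2 children of crux 2 above. The eventual-probability
/ a.e.-source / null-modification glue of the Assembly stays inside its proof. No target block is
filed: X_IG is literally items 2 ∧ 4 ∧ EventualTight. The LERW control and the off-critical (x ≠
x_c) failure are refuter experiments, not items.

CHEAPEST FALSIFIER. The κ-dressing test of FlowLineMeanValue (recipe and edge-data rule in
Definition requests, D2/TEST): pivot-sample 10⁴ critical SAWs (x_c ≈ 0.3790523) in the box
{−N..N}×{0..2N}, N = 100 then 200, bottom-mid to top-mid; per sample and k ∈ {N/2, N, 2N} one sparse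
Dirichlet solve on the box minus γ[0,k] with data d = c − s·θ; record M_k(z) at 25 interior points
and test the martingale increments E[(M_k′ − M_k)(z)·1_A(γ[0,k])] for a few past events A, for s ∈
{0, 1/4, 1/3, 1/2} (κ = 4, 3, 8/3, 2). The line dies if s = 1/3 is not the unique dressing whose
increments decay when N doubles while the loop-erased-walk control passes at s = 1/2. Boxes ≤ 6×5 by
exact enumeration (companion C4) are inconclusive — Kennedy-scale sampling is needed (Kennedy2002,
Kennedy2004). Not run here (compute-free hub, no SAW sampler in kit).

NUMBERS. κ = 8/3; χ = 2/√κ − √κ/2 = 1/√6 ≈ 0.408248; λ = π/√κ = π√(3/8) ≈ 1.923825; λ′ = π√κ/4 =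
π/√6 ≈ 1.282550; coefficient of arg g′: (4−κ)/4 = πχ/(2λ) = 1/3; bank constants in H-normalisation:
(π/2)(λ′/λ) = πκ/8 = π/3, jump across the curve 2π/3, angle gap 2λ′/χ = πκ/(4−κ) = 2π exactly at κ =
8/3 (MillerSheffield2016 critical angle; companion C1); far field H_t(z) − arg z = −W_t·Im(1/z) −
½(W_t² − (8/3)t)·Im(1/z²) + O(|z|⁻³); controls s = (4−κ)/4: κ = 4 ↔ 0 (harmonic explorer,
SchrammSheffield2005), κ = 3 ↔ 1/4, κ = 2 ↔ 1/2 (LERW); μ(ℤ²) ≈ 2.63815853, x_c ≈ 0.3790523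
(LawlerSchrammWerner2004SAW §3.1: 2.6 ≤ μ ≤ 2.7 rigorously).

DEFINITION REQUESTS. D1 (for crux 3) slitEdgeDirichletExtension, topic
Literature/Probability/LatticeModels (next to LatticeLaplacian.lean): for finite S ⊆ ℤ² and EDGE
data g : Site 2 → Site 2 → ℝ, the unique u : Site 2 → ℝ with 4·u v = Σ_(w ∼ v) (if w ∈ S then u w
else g v w) for v ∈ S (u = 0 off S); existence/uniqueness reduce to the proved vertex case
(dirichletOperator_injective, maximum principle) — provable now; needed because flow-line data along
a slit are two-sided.
D2 (for crux 3) flowLineEdgeData, topic Summits/CriticalPhenomena/SAWScalingLimit/Theorems (new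
object), with the coefficient s as a parameter (s = (4−κ)/4; SAW s = 1/3, controls s = 0 harmonic
explorer, 1/4 Ising, 1/2 LERW): for a lattice Dobrushin domain with explored self-avoiding path (U;
a, b; η) the edge datum of an interior vertex v off η towards a non-interior or on-η neighbour w is
d(v→w) = c − s·θ, where θ is the ccw boundary-tangent angle arg(i(w − v)) (angles ccw from the
x-axis) lifted continuously along the boundary of U ∖ η — anchored at a by the inward normal, the
2π-defect placed at b — and c = 0 on the right arc and right bank, π on the left arc and left bank,
with the harmonic-explorer jump at the tip (cap edge v = η_k + d_in: d = π/2 − s(θ_k − π/2)). Local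
reading on a path vertex w = η_j (d_in, d_out the steps into/out of η_j; θ_j the lifted heading of
d_in, obtained by prepending the phantom outside neighbour of a and accumulating the ±π/2 turns,
Literature.Probability.LatticeModels.winding): tangent i(w−v) = d_in ⇒ left bank, d = π − sθ_j; =
d_out ⇒ left bank, d = π − sθ_(j+1); = −d_in ⇒ right bank, d = s(π − θ_j); = −d_out ⇒ right bank, d
= s(π − θ_(j+1)). TEST instance (the Cheapest falsifier's box {−N..N}×{0..2N}, a = (0,0), b =
(0,2N), phantom step (0,−1)→a so θ_0 = π/2): below the bottom wall d = 0 (v.x > 0), π (v.x < 0);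
beyond the right wall −sπ/2; beyond the left wall π + sπ/2; above the top wall −sπ (v.x > 0), π + sπ
(v.x < 0), π/2 (v.x = 0, above b). Sanity: the rule is invariant under x ↦ −x with d ↦ π − d; in ℍ
with a north-going curve it returns arcs 0 / π and banks π/6 / 5π/6 at s = 1/3, i.e. 𝔥 = ±λ on the
arcs and ±λ′ on the banks under 𝔥 = λ − (2λ/π)·d, as in MillerSheffield2016 Fig. 1.10.
Cite fact wanted (for crux 4 / EventualTight): Kemppainen–Smirnov 2017 Thm 1.5 + Cor 1.7 for
families satisfying Literature.Probability.RandomPlanarGeometry.ConditionG2 (outputs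
IsTightAlongMesh, a.e. IsLoewnerDescribable, convergence in law of driving processes).

Novelty: Searches (2026-08-15): lit vsearch ×2 ("the SAW as a flow line of the GFF; imaginary geometry
coupling; winding in the boundary data of a harmonic function; martingale identifying SLE 8/3" — 10
textbook hits (Lawler 2005, Madras–Slade, …), none relevant; papers-only filter: 0 docs), lit search
--source crossref "self-avoiding walk imaginary geometry flow line" (12 rows: Madras–Slade chapters,
directed/interacting walks — nothing on IG), lit frontier CriticalPhenomena --since 2020 (30 newest
descendants: sub-ballisticity arXiv:2310.17299, SLE regularity, CLE connectivities — none couples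
the SAW with a GFF/IG observable); local FTS daemon, OpenAlex, S2, arXiv and galaxy were unavailable
today (connection reset / HTTP 429 / queue saturated) — so the card's and the novelty audit's
searches are relied on too (lit vsearch ×2, galaxy pdf bm25 "lattice interfaces as IG flow lines
with winding height data": Henkel–Karevski, Smirnov ICM, Jacobsen; 50 sibling cards checked, only
welding-zipper-identification / tilted-harmonic-explorer / discrete-imaginary-geometry-chi are
IG-flavoured and all differ in mechanism). Nearest prior art found: MillerSheffield2016 (IG I Thms
1.1–1.2: coupling, martingale 𝔥_t, constants λ, λ′, χ) = the content of support IGDrivingMartingales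
up to the far-field bookkeeping; SchrammSheffield2005 / SchrammSheffield2009 (discrete-harmonic
martingale identification of SLE₄) = the observable TYPE; Kenyon–Miller–Sheffield–Wilson
arXiv:1511.04068 (bipolar orientatio  [refs: 2310.17299, 1511.04068, MillerSheffield2016, SchrammSheffield2005, SchrammSheffield2009, DuminilCopinSmirnov2012, Nienhuis1982, CDHKSCRAS2014]

Barriers (technique_class: gff-flowline-martingale, dirichlet-observable): - technique_class: gff-flowline-martingale, dirichlet-observable
- Literature.Barriers.CriticalPhenomena.NienhuisWeightsExcludeVertexSAW: applies in spirit (no exact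
local linear relation for uniform-ℤ² SAW observables) and is conceded — no item claims an exact
lattice identity: FlowLineMeanValue is asymptotic and averaged (the barrier's recorded evasion
"statements about the limit"), IGMartingaleLimit lives on subsequential limits; the cost is that
there is no algebraic engine, and the bet is that a positive, elliptic (Dirichlet) identity is
provable where a Riemann–Hilbert one is not.
- Literature.Barriers.CriticalPhenomena.ParafermionicHalfCauchyRiemann: evaded by construction — no
discrete holomorphicity is asked; the winding sits linearly in the Dirichlet data of a well-posed
discrete Dirichlet problem (existence/uniqueness proved in LatticeLaplacian.lean).
- Literature.Barriers.CriticalPhenomena.EmbeddingModulusUniqueness: evaded as LERW and the harmonic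
explorer evade it — the observable is built from the discrete Laplacian of the given embedding and
from Euclidean winding (embedding-specific input), so no embedding-blind argument is asked to
produce rotations (Beffara2008).
- Literature.Barriers.CriticalPhenomena.SAWNotKineticallyGrown: respected — the exploration
filtration is that of the two-point x_c measure, whose conditional future given γ[0,k] is EXACTLY
the x_c-SAW of the slit domain from the tip (consistency of the chordal Gibbs family), not a kinetic
transiti

History (route lifecycle, newest last):
- 2026-08-25T12:40:23Z · DORMANT — reconciler: no traction for 7.7 d (last activity item-evidence-added at 2026-08-17T19:14:43Z); parked, not closed — `ledger route dormant route-CriticalPhenomen (operator:999:4088156)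

sub-problem: SAWScalingLimit · status: dormant · opened planner-plancard-CriticalPhenomena-SAWScaling-62e69eed-0 2026-08-15T11:43:35Z · rev 1 · ledger route-CriticalPhenomena-SAWImaginaryGeometry
GENERATED by the gate from the ledger (D-0016/17). Provers cite these decls: `theorem foo : Summit.CriticalPhenomena.SAWScalingLimit.Theses.SAWImaginaryGeometry.<Decl> := …` in Summits/CriticalPhenomena/SAWScalingLimit/Theorems/<Name>.lean.
-/

namespace Summit.CriticalPhenomena.SAWScalingLimit.Theses.SAWImaginaryGeometry

open scoped BigOperators Topology Manifold Classical MeasureTheory ProbabilityTheory Matrix InnerProductSpace ComplexConjugate ContinuousMap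
open Filter Set Function TopologicalSpace MeasureTheory

attribute [summit_statement] _root_.SAWScalingLimit

/-- item stmt-CriticalPhenomena-5942 · crux · rank 2 · open · by planner
why it might fail: As strong as SAW→SLE(8/3) given (KS): no lattice engine yet (FlowLineMeanValue conjectural; no exact Z² identity, NienhuisWeightsExcludeVertexSAW), and IsEndpointApprox admits interior endpoints a_δ at depth ≫ δ (EndpointRobust stmt-0776 untested).
sources: MillerSheffield2016, Dubedat2009, SchrammSheffield2005, SchrammSheffield2009, LawlerSchrammWerner2004SAW, DuminilCopinSmirnov2012
[crux] (IG) of the thesis — the κ = 8/3 imaginary-geometry cylinder identity for every subsequential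
weak limit of the critical square-lattice SAW laws, through every chordal uniformizer, given a.e.
Loewner describability; this is the card's r2 + r3 in their continuum, assembly-consumable form (the
lattice engine is crux 3 FlowLineMeanValue, informal until its definitions land). H_t(z) =
arg(Loewner.map W T z − W T) + (1/3)·arg(deriv (Loewner.map W T) z), T = t ∧ (Im z)²/9, W =
drivingFunction φ c; in the short-time regime both args are the continuous branches (Im(g − W) > 0;
|arg g′| ≤ 1/2), so H is bounded. [difficulty: open-problem] -/
@[route_item "route-CriticalPhenomena-SAWImaginaryGeometry", crux]
def IGMartingaleLimit : Prop :=
  ∀ (D : Literature.Probability.RandomPlanarGeometry.DobrushinDomain) (a b : ℝ → Literature.Probability.LatticeModels.Site 2), Literature.Probability.RandomPlanarGeometry.SAW.IsEndpointApprox D a b → ∀ (s : ℕ → ℝ) (μ : MeasureTheory.Measure (Literature.Probability.RandomPlanarGeometry.CurveClass ℂ)), Filter.Tendsto s Filter.atTop (nhdsWithin 0 (Set.Ioi 0)) → MeasureTheory.IsProbabilityMeasure μ → (∀ f : BoundedContinuousFunction (Literature.Probability.RandomPlanarGeometry.CurveClass ℂ) ℝ, Filter.Tendsto (fun n => ∫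 γ, f γ.curve ∂(Literature.Probability.RandomPlanarGeometry.SAW.law D.carrier (s n) (a (s n)) (b (s n)))) Filter.atTop (nhds (∫ x, f x ∂μ))) → ∀ φ : Literature.Probability.RandomPlanarGeometry.ConformalEquiv UpperHalfPlane.upperHalfPlaneSet D.carrier, D.IsChordalUniformizing φ → (∀ᵐ c ∂μ, Literature.Probability.RandomPlanarGeometry.IsLoewnerDescribable φ c) → (let H : Literature.Probability.RandomPlanarGeometry.CurveClass ℂ → NNReal → ℂ → ℝ := fun c t z => Complex.arg (Literature.Probability.RandomPlanarGeometry.Loewner.map (Literature.Probability.RandomPlanarGeometry.drivingFunction φ c) (min t (z.im ^ 2 / 9).toNNReal) z - (Literature.Probability.RandomPlanarGeometry.drivingFunction φ c (min t (z.im ^ 2 / 9).toNNReal) : ℂ)) + (1 / 3 : ℝ) * Complex.arg (deriv (Literature.Probability.RandomPlanarGeometry.Loewner.map (Literature.Probability.RandomPlanarGeometry.drivingFunction φ c) (min t (z.im ^ 2 / 9).toNNReal)) z); ∀ z : ℂ, 0 < z.im → ∀ s' t' : NNReal, s' ≤ t' → ∀ (n : ℕ) (S : Fin n → NNReal), (∀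 k, S k ≤ s') → ∀ ψ : (Fin n → ℝ) → ℝ, Continuous ψ → (∀ v, |ψ v| ≤ 1) → ∫ c, (H c t' z - H c s' z) * ψ (fun k => Literature.Probability.RandomPlanarGeometry.drivingFunction φ c (S k)) ∂μ = 0)

/-- item stmt-CriticalPhenomena-5943 · crux · rank 4 · open · by planner
why it might fail: No crossing/RSW technology for the critical SAW (no FKG at n = 0; KS17 §4 verifies G2 for FK, percolation, HE, LERW only); sub-ballisticity (DCH13; arXiv:2310.17299 on Hex) is the strongest input; interior-endpoint approximations are included as typed.
sources: KemppainenSmirnov2017, AizenmanBurchardDuke1999, DuminilCopinHammond2013, arXiv:2310.17299, Literature.Probability.RandomPlanarGeometry.ConditionG2, Literature.Probability.RandomPlanarGeometry.IsLoewnerDescribable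
[crux] (KS) of the thesis — for every Dobrushin domain, endpoint approximation, subsequential weak
limit μ (probability) of the SAW laws and chordal uniformizer φ, μ-a.e. curve class is
Loewner-describable through φ (Literature.Probability.RandomPlanarGeometry.IsLoewnerDescribable:
some continuous driving function generates the curve through φ). Intended engine: Kemppainen–Smirnov
Thm 1.5 / Cor 1.7 from an annulus-crossing bound (Condition G2/C2) for the x_c-SAW in slit domains
(the domain Markov property of the two-point x_c measure is exact); describability through one
uniformizer gives it through all (dilations, Loewner scaling). [difficulty: XL] -/
@[route_item "route-CriticalPhenomena-SAWImaginaryGeometry", crux]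
def SubseqDescribable : Prop :=
  ∀ (D : Literature.Probability.RandomPlanarGeometry.DobrushinDomain) (a b : ℝ → Literature.Probability.LatticeModels.Site 2), Literature.Probability.RandomPlanarGeometry.SAW.IsEndpointApprox D a b → ∀ (s : ℕ → ℝ) (μ : MeasureTheory.Measure (Literature.Probability.RandomPlanarGeometry.CurveClass ℂ)), Filter.Tendsto s Filter.atTop (nhdsWithin 0 (Set.Ioi 0)) → MeasureTheory.IsProbabilityMeasure μ → (∀ f : BoundedContinuousFunction (Literature.Probability.RandomPlanarGeometry.CurveClass ℂ) ℝ, Filter.Tendsto (fun n => ∫ γ, f γ.curve ∂(Literature.Probability.RandomPlanarGeometry.SAW.law D.carrier (s n) (a (s n)) (b (s n)))) Filter.atTop (nhds (∫ x, f x ∂μ))) → ∀ φ : Literature.Probability.RandomPlanarGeometry.ConformalEquiv UpperHalfPlane.upperHalfPlaneSet D.carrier, D.IsChordalUniformizing φ → ∀ᵐ c ∂μ, Literature.Probability.RandomPlanarGeometry.IsLoewnerDescribable φ c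

-- item stmt-CriticalPhenomena-6979 · support · rank 3 · open · by planner — informal only, no Lean statement yet:
--   [crux] r3 FlowLineMeanValue — the LATTICE ENGINE of the route (idea card
--   imaginary-geometry-winding-dirichlet K1 + companion ig-seamless-companion C2; informal until
--   definitions D1 slitEdgeDirichletExtension and D2 flowLineEdgeData land). For a finite simply
--   connected lattice Dobrushin domain (U ⊂ ℤ²; a, b boundary-attached) and the critical two-point SAW
--   law P_{U;a,b}(γ) ∝ x_c^{|γ|} (Literature.Probability.RandomPlanarGeometry.SAW.law at mesh 1, x_c =
--   SAW.criticalFugacity), let X_η(z) be the value at the interior vertex z of the edge-data discrete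
--   harmonic extension (D1) on U minus the path η

/-- item stmt-CriticalPhenomena-10942 · support · rank 9 · closed · proved by Summit.CriticalPhenomena.SAWScalingLimit.Theorems.IGLawEventuallyProb_proof @ 9b30f68467b7 (prover) · by planner
[support] EVENTUAL WELL-POSEDNESS of the critical SAW law (glue input, provable now — a complete
sorry-free proof is attached as evidence LawEventuallyProb_evidence.lean): for every Dobrushin
domain and endpoint approximation, SAW.law D.carrier δ (a δ) (b δ) is a probability measure for all
small δ > 0, i.e. 0 < Z_δ < ∞: finitely many SAWs in the bounded Ω_δ (supports are duplicate-free
lists over the finite site set insert (a δ) (meshDomain Ω δ), meshDomain_finite), at least one by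
IsEndpointApprox.reachable (Walk.toPath), and x_c = 1/μ > 0 (straight walk ⇒ c_n ≥ 1 ⇒ μ = inf
c_n^{1/n} ≥ 1). Needed because the Prokhorov criterion convergesInLawToSLE_of_isTightAlongMesh
consumes probability laws while SAW.law is the junk 0 when a δ, b δ are not joined. Sources:
LawlerSchrammWerner2004SAW §3.1, §3.4.2; DuminilCopinSmirnov2012 §4;
Literature.Probability.RandomPlanarGeometry.SAW.law;
Literature.Probability.LatticeModels.meshDomain_finite. [difficulty: S] -/
@[route_item "route-CriticalPhenomena-SAWImaginaryGeometry", crux]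
def LawEventuallyProb : Prop :=
  ∀ (D : Literature.Probability.RandomPlanarGeometry.DobrushinDomain) (a b : ℝ → Literature.Probability.LatticeModels.Site 2), Literature.Probability.RandomPlanarGeometry.SAW.IsEndpointApprox D a b → ∀ᶠ δ in nhdsWithin (0 : ℝ) (Set.Ioi 0), MeasureTheory.IsProbabilityMeasure (Literature.Probability.RandomPlanarGeometry.SAW.law D.carrier δ (a δ) (b δ))

/-- item stmt-CriticalPhenomena-1881 · support · rank 9 · open · by planner
sources: KemppainenSmirnov2017, AizenmanBurchardDuke1999, Literature.Probability.RandomPlanarGeometry.IsTightAlongMesh, Summit.CriticalPhenomena.SAWScalingLimit.Theorems.SAWParafermionTight_refuted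
[support] EVENTUAL TIGHTNESS of the critical SAW laws: for every Dobrushin domain and endpoint
approximation, IsTightAlongMesh (fun δ γ => γ.curve) (fun δ => SAW.law D δ a_δ b_δ) — for every ε
some compact set of CurveClass ℂ carries all but ε of the mass for all small δ. This is the form the
Prokhorov criterion convergesInLawToSLE_of_isTightAlongMesh consumes and the repair of the refuted
all-δ Tight (IsTightLaws over δ ∈ (0,1]) suggested by the refuting theorem; offered to routes
SAWParafermion / SAWConfRestriction as their restated r3/r4. -/
@[route_item "route-CriticalPhenomena-SAWImaginaryGeometry", crux]
def EventualTight : Prop :=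
  ∀ (D : Literature.Probability.RandomPlanarGeometry.DobrushinDomain) (a b : ℝ → Literature.Probability.LatticeModels.Site 2), Literature.Probability.RandomPlanarGeometry.SAW.IsEndpointApprox D a b → Literature.Probability.RandomPlanarGeometry.IsTightAlongMesh (fun δ (γ : Literature.Probability.RandomPlanarGeometry.SAW.DomainSAW D.carrier δ (a δ) (b δ)) => γ.curve) (fun δ => Literature.Probability.RandomPlanarGeometry.SAW.law D.carrier δ (a δ) (b δ))

/-- item stmt-CriticalPhenomena-5944 · support · rank 9 · open · by planner
sources: CDHKSCRAS2014, MillerSheffield2016, Literature.Probability.RandomPlanarGeometry.Loewner.isLocalMartingale_hasQuadraticVariation_of_spinCylinderIdentity, Literature.Probability.RandomPlanarGeometry.Loewner.FarRegime, Literature.Probability.RandomPlanarGeometry.Loewner.ShortTime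
[support] continuum extraction, provable now on the pattern of
Loewner.isLocalMartingale_hasQuadraticVariation_of_spinCylinderIdentity
(SpinObservableLocalMartingale.lean): on any probability space, a real process W with strongly
measurable marginals, continuous paths and W_0 = 0 whose time-limited κ = 8/3 observables H_t(z) =
arg(g_t(z) − W_t) + (1/3)·arg g_t′(z) satisfy the cylinder identity at every z ∈ ℍ has W/√(8/3) a
continuous local martingale with ⟨W/√(8/3)⟩_t = t in its natural filtration. Proof sketch: monotone
class ⇒ H_(·∧T_z)(z) are bounded martingales; far field (FarRegime, g_t = z + 2t/z + 2∫W/z² + …):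
H_t(z) − arg z = −W_t·Im(1/z) − ½(W_t² − (8/3)t)·Im(1/z²) + O(((M+√t)/|z|)³); z = iy isolates W_t
(the 1/y² term vanishes on the axis), z = y·e^(iπ/4) then isolates W_t² − (8/3)t; localise at
far-field stopping times of fixed levels (moment-free), let y → ∞. [difficulty: L] -/
@[route_item "route-CriticalPhenomena-SAWImaginaryGeometry", crux]
def IGDrivingMartingales : Prop :=
  ∀ (Ω : Type) [MeasurableSpace Ω] (P : MeasureTheory.Measure Ω) [MeasureTheory.IsProbabilityMeasure P] (W : NNReal → Ω → ℝ) (hW : ∀ t, MeasureTheory.StronglyMeasurable (W t)), (∀ ω, Continuous (W · ω)) → (∀ ω, W 0 ω = 0) → (let H : NNReal → Ω → ℂ → ℝ := fun t ω z => Complex.arg (Literature.Probability.RandomPlanarGeometry.Loewner.map (W · ω) (min t (z.im ^ 2 / 9).toNNReal) z - (W (min t (z.im ^ 2 / 9).toNNReal) ω : ℂ)) + (1 / 3 : ℝ) * Complex.arg (deriv (Literature.Probability.RandomPlanarGeometry.Loewner.map (W · ω) (min t (z.im ^ 2 / 9).toNNReal)) z); ∀ z : ℂ, 0 < z.im → ∀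 s t : NNReal, s ≤ t → ∀ (n : ℕ) (S : Fin n → NNReal), (∀ k, S k ≤ s) → ∀ ψ : (Fin n → ℝ) → ℝ, Continuous ψ → (∀ v, |ψ v| ≤ 1) → ∫ ω, (H t ω z - H s ω z) * ψ (fun k => W (S k) ω) ∂P = 0) → Literature.Probability.RandomPlanarGeometry.IsLocalMartingale (fun t ω => (Real.sqrt (8 / 3))⁻¹ * W t ω) (MeasureTheory.Filtration.natural W hW) P ∧ Literature.Probability.Process.HasQuadraticVariation (fun t ω => (Real.sqrt (8 / 3))⁻¹ * W t ω) (fun t _ => (t : ℝ)) (MeasureTheory.Filtration.natural W hW) P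

/-- item stmt-CriticalPhenomena-5945 · assembly · rank 1 · open · by planner
sources: Literature.Probability.RandomPlanarGeometry.convergesInLawToSLE_of_isTightAlongMesh, Literature.Probability.RandomPlanarGeometry.isSLELaw_of_isLocalMartingale_driving_of_lt_four, Literature.Probability.RandomPlanarGeometry.MarkedDomain.exists_isChordalUniformizing_holds, Literature.Probability.RandomPlanarGeometry.IsSLECurve.map_eq_holds, Literature.Probability.RandomPlanarGeometry.isLoewnerDescribed_iff_isDrivenBy, Literature.Probability.RandomPlanarGeometry.SAW.aemeasurable_curve
[assembly] IGDrivingMartingales → IGMartingaleLimit → SubseqDescribable → EventualTight →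
SAWScalingLimit (pure logic plus the proved reductions named above; estimated M). -/
@[route_item "route-CriticalPhenomena-SAWImaginaryGeometry"]
def Assembly : Prop :=
  IGDrivingMartingales → IGMartingaleLimit → SubseqDescribable → EventualTight → SAWScalingLimit

/-! D-0027 §2.1 — DECIDING THEOREM (planner-authored via `route open/edit --closes-file`; by planner-rbadge-CriticalPhenomena-SAWImaginaryG-5c2ec369-g4-0 2026-08-15T16:54:54Z):
its hypotheses are this route's items and its conclusion the sub-problem Statement (glue_lint), and it elaborates with this file. -/

@[closes "route-CriticalPhenomena-SAWImaginaryGeometry"] theorem closes (hD : IGDrivingMartingales) (hM : IGMartingaleLimit) (hS : SubseqDescribable)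
    (hT : EventualTight) (hP : LawEventuallyProb) : _root_.SAWScalingLimit := by
  classical
  intro D a b hab
  have hX : ∀ δ : ℝ, Measurable (fun γ : Literature.Probability.RandomPlanarGeometry.SAW.DomainSAW D.carrier δ (a δ) (b δ) => γ.curve) :=
    fun δ => Literature.Probability.RandomPlanarGeometry.SAW.DomainSAW.measurable_of_top _
  -- the SAW laws are probability measures for small meshes; the padded family `P'`
  have hev := hP D a b hab
  obtain ⟨δ₁, hδ₁⟩ := hev.exists
  set ν : ℝ → MeasureTheory.Measure (Literature.Probability.RandomPlanarGeometry.CurveClass ℂ) := fun δ =>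
    (Literature.Probability.RandomPlanarGeometry.SAW.law D.carrier δ (a δ) (b δ)).map (fun γ => γ.curve) with hν
  have hνprob : ∀ δ, IsProbabilityMeasure (Literature.Probability.RandomPlanarGeometry.SAW.law D.carrier δ (a δ) (b δ)) →
      IsProbabilityMeasure (ν δ) := fun δ hδ => by
    simp only [hν]; exact Measure.isProbabilityMeasure_map (hX δ).aemeasurable
  have hνapply : ∀ (δ : ℝ) (S : Set (Literature.Probability.RandomPlanarGeometry.CurveClass ℂ)), MeasurableSet S →
      ν δ S = Literature.Probability.RandomPlanarGeometry.SAW.law D.carrier δ (a δ) (b δ) ((fun γ => γ.curve) ⁻¹' S) :=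
    fun δ S hS => by simp only [hν]; exact Measure.map_apply (hX δ) hS
  have hint : ∀ (δ : ℝ) (f : BoundedContinuousFunction (Literature.Probability.RandomPlanarGeometry.CurveClass ℂ) ℝ),
      ∫ c, f c ∂(ν δ) = ∫ γ, f γ.curve ∂(Literature.Probability.RandomPlanarGeometry.SAW.law D.carrier δ (a δ) (b δ)) :=
    fun δ f => by simp only [hν]; exact integral_map (hX δ).aemeasurable f.continuous.aestronglyMeasurable
  set P' : ℝ → MeasureTheory.Measure (Literature.Probability.RandomPlanarGeometry.CurveClass ℂ) := fun δ =>
    if IsProbabilityMeasure (ν δ) then ν δ else ν δ₁ with hP'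
  have hP'eq : ∀ δ, IsProbabilityMeasure (Literature.Probability.RandomPlanarGeometry.SAW.law D.carrier δ (a δ) (b δ)) → P' δ = ν δ :=
    fun δ hδ => by simp only [hP', if_pos (hνprob δ hδ)]
  haveI hP'prob : ∀ δ, IsProbabilityMeasure (P' δ) := fun δ => by
    by_cases h : IsProbabilityMeasure (ν δ)
    · simp only [hP', if_pos h]; exact h
    · simp only [hP', if_neg h]; exact hνprob δ₁ hδ₁
  -- (1) tightness of the padded family (item `EventualTight`)
  have hT' : Literature.Probability.RandomPlanarGeometry.IsTightAlongMesh (fun (_ : ℝ) (c : Literature.Probability.RandomPlanarGeometry.CurveClass ℂ) => c) P' := by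
    intro ε hε
    obtain ⟨K, hK, hevK⟩ := hT D a b hab ε hε
    refine ⟨K, hK, ?_⟩
    filter_upwards [hevK, hev] with δ hδK hδ
    show P' δ Kᶜ ≤ ε
    rw [hP'eq δ hδ, hνapply δ Kᶜ hK.isClosed.measurableSet.compl]
    exact hδK
  -- (2) every subsequential limit is the chordal SLE(8/3) law (items IG, KS, IGDrivingMartingales)
  have hL' : ∀ μ : MeasureTheory.Measure (Literature.Probability.RandomPlanarGeometry.CurveClass ℂ), IsProbabilityMeasure μ →
      Literature.Probability.RandomPlanarGeometry.IsSubseqLimitLaw (fun (_ : ℝ) (c : Literature.Probability.RandomPlanarGeometry.CurveClass ℂ) => c) P' μ →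
      Literature.Probability.RandomPlanarGeometry.IsSLELaw ((8 : NNReal) / 3) D μ := by
    intro μ hμ hsub
    obtain ⟨s, hs, hlim'⟩ := hsub
    haveI := hμ
    have h1 : ∀ᶠ n in atTop,
        IsProbabilityMeasure (Literature.Probability.RandomPlanarGeometry.SAW.law D.carrier (s n) (a (s n)) (b (s n))) := hs.eventually hev
    have hlim : ∀ f : BoundedContinuousFunction (Literature.Probability.RandomPlanarGeometry.CurveClass ℂ) ℝ,
        Tendsto (fun n => ∫ γ, f γ.curve ∂(Literature.Probability.RandomPlanarGeometry.SAW.law D.carrier (s n) (a (s n)) (b (s n))))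
          atTop (𝓝 (∫ x, f x ∂μ)) := fun f => by
      refine (hlim' f).congr' ?_
      filter_upwards [h1] with n hn
      rw [hP'eq _ hn, hint]
    obtain ⟨φ, hφ⟩ := Literature.Probability.RandomPlanarGeometry.MarkedDomain.exists_isChordalUniformizing_holds D
    have hdesc : ∀ᵐ c ∂μ, Literature.Probability.RandomPlanarGeometry.IsLoewnerDescribable φ c := hS D a b hab s μ hs hμ hlim φ hφ
    -- the limit is carried by curves from `a`: test against `c ↦ min 1 (dist c.source a)`
    have h0 : ∀ᵐ c ∂μ, c.source = D.pt 0 := by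
      have hbd : ∀ c : Literature.Probability.RandomPlanarGeometry.CurveClass ℂ, 0 ≤ min 1 (dist c.source (D.pt 0)) ∧
          min 1 (dist c.source (D.pt 0)) ≤ 1 := fun c => ⟨le_min zero_le_one dist_nonneg, min_le_left _ _⟩
      set g : BoundedContinuousFunction (Literature.Probability.RandomPlanarGeometry.CurveClass ℂ) ℝ := BoundedContinuousFunction.mkOfBound
        ⟨fun c => min 1 (dist c.source (D.pt 0)),
          continuous_const.min (Literature.Probability.RandomPlanarGeometry.CurveClass.continuous_source.dist continuous_const)⟩ 1
        (fun c c' => by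
          simp only [ContinuousMap.coe_mk, Real.dist_eq]
          have := hbd c; have := hbd c'
          rw [abs_le]; constructor <;> linarith) with hg
      have hg_apply : ∀ c, g c = min 1 (dist c.source (D.pt 0)) := fun c => rfl
      have hval : ∀ᶠ n in atTop, ∫ γ, g γ.curve ∂(Literature.Probability.RandomPlanarGeometry.SAW.law D.carrier (s n) (a (s n)) (b (s n))) =
          min 1 (dist (Literature.Probability.LatticeModels.meshPoint (s n) (a (s n))) (D.pt 0)) := by
        filter_upwards [h1] with n hn
        haveI := hn
        have hsrc : ∀ γ : Literature.Probability.RandomPlanarGeometry.SAW.DomainSAW D.carrier (s n) (a (s n)) (b (s n)),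
            γ.curve.source = Literature.Probability.LatticeModels.meshPoint (s n) (a (s n)) := fun γ => by
          simp only [Literature.Probability.RandomPlanarGeometry.SAW.DomainSAW.curve, Literature.Probability.RandomPlanarGeometry.CurveClass.source_mk, Literature.Probability.RandomPlanarGeometry.Curve.source]
          exact SimpleGraph.Walk.toCurve_apply_zero (Literature.Probability.LatticeModels.meshPoint (s n)) γ.walk
        simp_rw [hg_apply, hsrc]
        rw [integral_const]; simp
      have hto0 : Tendsto (fun n => min 1 (dist (Literature.Probability.LatticeModels.meshPoint (s n) (a (s n))) (D.pt 0)))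
          atTop (𝓝 0) := by
        have h' := (hab.tendsto_fst.comp hs).dist (tendsto_const_nhds (x := D.pt 0))
        have h'' := (tendsto_const_nhds (x := (1 : ℝ))).min h'
        simpa [Function.comp] using h''
      have hint0 : ∫ c, g c ∂μ = 0 :=
        tendsto_nhds_unique (hlim g) (hto0.congr' (by filter_upwards [hval] with n hn; exact hn.symm))
      have hae := (integral_eq_zero_iff_of_nonneg (fun c => (hbd c).1) (g.integrable μ)).1 hint0
      filter_upwards [hae] with c hc
      have hc' : min 1 (dist c.source (D.pt 0)) = 0 := hc
      rcases min_eq_iff.1 hc' with ⟨h1, -⟩ | ⟨h2, -⟩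
      · exact absurd h1 one_ne_zero
      · exact dist_eq_zero.1 h2
    have hcyl := hM D a b hab s μ hs hμ hlim φ hφ hdesc
    -- the version `W' = W - W 0` of the Loewner transform `W = drivingFunction φ`
    have hae0 := Literature.Probability.RandomPlanarGeometry.ae_drivingFunction_apply_zero hφ h0
    set Wt : NNReal → Literature.Probability.RandomPlanarGeometry.CurveClass ℂ → ℝ := fun t c =>
      Literature.Probability.RandomPlanarGeometry.drivingFunction φ c t - Literature.Probability.RandomPlanarGeometry.drivingFunction φ c 0 with hWt
    have hWsm : ∀ t, MeasureTheory.StronglyMeasurable (Wt t) := fun t =>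
      (Literature.Probability.RandomPlanarGeometry.stronglyMeasurable_drivingFunction_apply hφ t).sub
        (Literature.Probability.RandomPlanarGeometry.stronglyMeasurable_drivingFunction_apply hφ 0)
    have hWc : ∀ c, Continuous (Wt · c) := fun c =>
      (Literature.Probability.RandomPlanarGeometry.continuous_drivingFunction φ c).sub continuous_const
    have hW0 : ∀ c, Wt 0 c = 0 := fun c => sub_self _
    obtain ⟨hloc, hQ⟩ := hD (Literature.Probability.RandomPlanarGeometry.CurveClass ℂ) μ Wt hWsm hWc hW0 (by
      intro H z hz s' t' hst n S hS ψ hψc hψb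
      refine Eq.trans (integral_congr_ae ?_) (hcyl z hz s' t' hst n S hS ψ hψc hψb)
      filter_upwards [hae0] with c hc0
      simp only [H, hWt, hc0, sub_zero]
      try rfl)
    -- (3) Lévy characterisation + SLE(κ) trace/transience for κ < 4: no named fact
    have hκ0 : (0 : NNReal) < 8 / 3 := by rw [← NNReal.coe_pos]; push_cast; norm_num
    have hκ4 : (8 : NNReal) / 3 < 4 := by rw [← NNReal.coe_lt_coe]; push_cast; norm_num
    have hsq : Real.sqrt (((8 : NNReal) / 3 : NNReal) : ℝ) = Real.sqrt (8 / 3) := by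
      rw [show (((8 : NNReal) / 3 : NNReal) : ℝ) = 8 / 3 by push_cast; norm_num]
    refine Literature.Probability.RandomPlanarGeometry.isSLELaw_of_isLocalMartingale_driving_of_lt_four hκ0 hκ4 hφ
      (W := fun c t => Wt t c) (fun t => (hWsm t).measurable) (ae_of_all _ hW0)
      (ae_of_all _ hWc) (𝓕 := MeasureTheory.Filtration.natural Wt hWsm) ?_ ?_ ?_
    · simpa only [hsq] using hloc
    · simpa only [hsq] using hQ
    · filter_upwards [hdesc, hae0] with c hc hc0
      have hcW : (fun t => Wt t c) = Literature.Probability.RandomPlanarGeometry.drivingFunction φ c := by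
        funext t; simp only [hWt, hc0, sub_zero]
      rw [hcW]
      obtain ⟨-, γ, hγ, c', hc', hI⟩ := Literature.Probability.RandomPlanarGeometry.isLoewnerDescribed_drivingFunction hc
      exact ⟨γ, hγ, c', hc', hI⟩
  -- (4) Prokhorov criterion for the padded family, transferred back to the SAW laws
  obtain ⟨Γ, hΓ, -, hTL⟩ := Literature.Probability.RandomPlanarGeometry.convergesInLawToSLE_of_isTightAlongMesh
    (Ωδ := fun _ : ℝ => Literature.Probability.RandomPlanarGeometry.CurveClass ℂ) (κ := (8 : NNReal) / 3) (D := D)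
    Literature.Probability.RandomPlanarGeometry.IsSLECurve.map_eq_holds (Eventually.of_forall fun δ => aemeasurable_id') hT' hL'
  refine ⟨Γ, hΓ, Eventually.of_forall fun δ => Literature.Probability.RandomPlanarGeometry.SAW.aemeasurable_curve _ _ _ _, ?_⟩
  intro f
  refine (hTL f).congr' ?_
  filter_upwards [hev] with δ hδ
  rw [hP'eq δ hδ, hint]

end Summit.CriticalPhenomena.SAWScalingLimit.Theses.SAWImaginaryGeometry
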